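import Summits.QuantumFields.YangMills.Theorems.BalabanUVNodesN22W1RelCentredTermDatum214WindowDilatedAdm
import Summits.QuantumFields.YangMills.Theorems.BalabanUVNodesN22W1RelCentredMembersOfDatumLG
import Summits.QuantumFields.YangMills.Theorems.BalabanUVNodesN22W1RelCentredMembersOfDatumLGCentred
import Summits.QuantumFields.YangMills.Theorems.BalabanUVNodesN22W1RelCentredMembersOfDatumTails
import Summits.QuantumFields.YangMills.Theorems.BalabanUVNodesN22W1RelCentredCentreOfDatum
import Summits.QuantumFields.YangMills.Theorems.BalabanUVNodesN22W1RelCentredSliceInputsLG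
import Literature.MathematicalPhysics.QuantumFieldTheory.Balaban1983to89.Node00.HistoryTermDatum214WindowDilated

/-!
# BalabanUVNodes ∕ node N22 = NE9 — THE RELATIVE-DISC CENTRED ROAD OVER THE ADMISSIBLE CLASS, MODULE J10c: THE KNIT AT THE DATUM, LOCAL-GROWTH ∕ ADMISSIBLE-HISTORY EDITION —
# `N22At` at the admissible reading of record on the run towers generated by the (2.14) term datum FROM the located inputs `SliceInputsLG` (NO Lemma-2-type letter of the unclipped
# pair; every older-term letter over W1-13's admissible class), J2ᴬ's engine with every member hypothesis discharged by J5, J10a∕J10b, J7a §1∕§2, J8 under the unscaled-field law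

Cell `pub-ymgap`, HUMAN RULING D-0062 (Track A), R134 ACCELERATION re-seat `pub-ymgap-dag-n22-c` (strategy s1), generation 8, file J10c (lens E6∕E7 + T32∕T35, def-W1 (R-a)∕W1-13;
this seat's `J10-DESIGN.md` §4 + the ᴬ sweep).  THEOREMS ONLY; imports J2ᴬ `…TermDatum214WindowDilatedAdm` (the guarded member-currency engine), J10a `…MembersOfDatumLG`, J10b
`…MembersOfDatumLGCentred`, J7a `…MembersOfDatumTails`, J8 `…CentreOfDatum`, J10-D `…SliceInputsLG` and node00-def-W1's W1-11 `Node00/HistoryTermDatum214WindowDilated` BY NAME.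
`--supports` K3⁷ `SpineGivenEndpointR13SepCoPH` (stmt-QuantumFields-20544) as a helper.

WHY ∕ WHAT.  Module J9's knit `…_unscaledLawDatum` VERBATIM in structure, re-pointed: (i) the engine is J2ᴬ (two more member hypotheses — the members' and the centre's φ-analyticity on the
new level's table at admissible older terms — and the analytic guard threaded through hMlast ∕ hMprop ∕ (P) ∕ hMcen, `hrestr`, STRICT [KP86] clause); (ii) the located inputs are ONE
`SliceInputsLG` record per slice (J10-D); (iii) hMlast ∕ hMprop read J10a (dag-n10-c 47 §2∕§3∕§4 from LOCAL growth letters), hMcen's centred piece and large-field member read J10b (46 §5,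
47 §5), the box tail ∕ box-free centre ∕ (P) keep J7a §1∕§2 ∕ J8 with their `Σ|τ||𝒪(·,0)|` letters now DERIVED from (L0) + the τ-radii + `hw₀` (§0 faces); (iv) the guard
«(1.18)`(E₀, li.κ)` on the space tables of record ∧ analytic there» the engine hands each bullet IS `old ∈ W1.AdmHist (W1.spaceOfRecord Sg Rz (fun _ => cs.α₀) (fun _ => cs.α₁)) E₀ li.κ k′`
(W1-13 `mem_AdmHist_spaceOfRecord_const_iff`, `Iff.rfl`), under which the record's older-term fields are read; (v) the two new engine goals are the record's `hMan` ∕ `hVan` at the slice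
`X := Z` through every point of the table.  Conclusion unchanged: `N22At (u3OfRecord₁₂ θ (Dr.u3Objects θ.γ) k)` (+ the ₁₃ face), `Dr := ReadingData.ofRecordAdm F M N (runTowers fun k₁ ↦
toClusterTower (Gn k₁)) …`, CONDITIONAL on `ι : ∀ slice, SliceInputsLG …` (NODE A kernel letters, capstone numerics, regions, box laws at s₀, (2.22), K-letters, LOCAL growth letters of the
potentials over the admissible class, the potentials' curve law, the member's ∕ centre's φ-analyticity), on `hlaw` (W1-11 BY NAME), on node N18 below and on `hrestr`.

HONEST FRAMING.  Count-neutral by-name knit AT THE OBJECT; NOT a discharge of N22: the located inputs are HYPOTHESES whose inhabitants are NODE A's ∕ N09's ∕ N10's ∕ def-W1's ∕ the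
capstone's business; node N18 below is N18's; the datum is DATA; no inhabitant of the record ∕ admissible tuple is claimed (K0 OPEN); vacuous where `AdmBg … = ∅`.  NE9 NOT IN PRINT for
d = 4; one finite four-torus programme at fixed ε — NOT infinite volume, NOT OS on ℝ⁴, NOT a mass gap, NOT Clay.  A6 (standing rule №189, director-ym №193): the located-input binder's
RECORD TYPE is inhabited in BOTH regimes at W1-7's degenerate datum — `sliceInputsLG_inhabited_largeField` (`1 ≤ |P(t)|`, module J10-W `…SliceInputsLGWitness`) and
`sliceInputsLG_inhabited_smallField` (`P(t) = ∅`, module J10-Wb `…SliceInputsLGWitnessSmallField`), for every nonempty `Z`, `φ`, tables, `s₀ > 0`, `Mv > 1`, at `ρb = 1∕12`,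
`a₅ = 2` (sibling files, not imported here; a JOINT witness with this knit's numerals ∕ `hlaw` ∕ N18-below is NOT claimed).  0 `sorry`, 0 `def`, standard axioms.

References (TYPES only): [II] = [Balaban1988RG2Cluster] (1.26) p. 8, (1.34)–(1.36) p. 9, (1.41)–(1.43) p. 11, (2.2)–(2.3) p. 12, (2.9)–(2.15) pp. 14–16, (2.16)–(2.26) pp. 16–17, Lemma 3
p. 20, (2.39)–(2.41) p. 21; [I] = [Balaban1987RG1] §1 p. 263, (2.9)–(2.13) pp. 266–268.
-/

noncomputable section

open scoped Matrix.Norms.L2Operator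

namespace YMDAG.N22.W1

open Set Metric Matrix
open scoped BigOperators
open Literature.MathematicalPhysics.QuantumFieldTheory.Balaban1983to89
open Literature.MathematicalPhysics.QuantumFieldTheory.Balaban1983to89.T4Continuum
open Literature.MathematicalPhysics.QuantumFieldTheory.Balaban1983to89.T4OutputRate
open Literature.MathematicalPhysics.QuantumFieldTheory.Balaban1983to89.TreeLengthTorus (TPt TDom tsys torusTreeLen torusTreeLen_nonneg)
open Literature.MathematicalPhysics.QuantumFieldTheory.Balaban1983to89.B12TreeDecay (K₀ K₀_pos)
open Literature.MathematicalPhysics.QuantumFieldTheory.Balaban1983to89.B13Lemma3TorusData (TBond)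
open Literature.MathematicalPhysics.QuantumFieldTheory.Balaban1983to89.B13Lemma3TorusTerms (terms weight weight_nonneg)
open Literature.MathematicalPhysics.QuantumFieldTheory.Balaban1983to89.B13Lemma3TorusSocket (Lemma3Numerics)
open Literature.MathematicalPhysics.QuantumFieldTheory.Balaban1983to89.B13Term214 (term214 core214 F214)
open Literature.MathematicalPhysics.QuantumFieldTheory.Balaban1983to89.B13Bound143 (invTau)
open Literature.MathematicalPhysics.QuantumFieldTheory.Balaban1983to89.B9Thm37GlueTorus (tdist1)
open Literature.MathematicalPhysics.QuantumFieldTheory.Balaban1983to89.B5TorusCover (UT)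
open Literature.MathematicalPhysics.QuantumFieldTheory.Balaban1983to89.Step (SFConsts)
open Literature.MathematicalPhysics.QuantumFieldTheory.Balaban1983to89.Node00
  (Stage12Params Stage13Params U3Objects₁₁ U3Letters₁₁ NE2Objects₁₁ NE3Letters₁₁ MatA ιSU prependCoupling)
open Literature.MathematicalPhysics.QuantumFieldTheory.Balaban1983to89.Node00.Sect2 (domSys domCount CPair ofBackgroundC spaceI domSites Setting Residual)
open Literature.MathematicalPhysics.QuantumFieldTheory.Balaban1983to89.Node00.W1
open YMDAG.UVSplit

open Literature.MathematicalPhysics.QuantumFieldTheory.Balaban1983to89.TreeLengthTorus (ineq126_torus tcubeSys)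

variable {N : ℕ} [NeZero N]

/-! ## §0 Faces of the record: the box-support law at a base point, the per-bond multiplicity of the rate weight ((1.26) on the torus), the centre's `Σ|τ||𝒪(·,0)|` letters -/

namespace SliceInputsLG

section Faces

variable {c₀ : B13.Consts} {P : Params} {𝔸 : Type*} [NormedRing 𝔸] [NormedAlgebra ℂ 𝔸] [CompleteSpace 𝔸] {M k L : ℕ} [NeZero L]
  {𝔇 : TermDatum214 c₀ P 𝔸 M k L}
  {χu χcu : (Z : (domSys P M (k + 1)).Dom) → (t : TermLabel P M k L) → ((𝔇.𝒦 Z t).Λ → ℝ) → ℝ}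
  {𝒲 : (Z : (domSys P M (k + 1)).Dom) → (t : TermLabel P M k L) → CPair P 𝔸 → TDom P.d (L * domCount P M (k + 1)) → ((𝔇.𝒦 Z t).Λ → ℝ) → ℂ}
  {𝒪 : (Z : (domSys P M (k + 1)).Dom) → (t : TermLabel P M k L) → OlderTerms P 𝔸 M k → CPair P 𝔸 → TDom P.d (L * domCount P M (k + 1)) →
    ((𝔇.𝒦 Z t).Λ → ℝ) → ℂ}
  {c : B13.Consts} {G : Type*} [GaugeGroup G] {Sg : Setting 𝔸 G} {Rz : Residual P 𝔸} {cs : SFConsts} {E₀ κE : ℝ}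
  {Z : (domSys P M (k + 1)).Dom} {t : TermLabel P M k L} {φ : CPair P 𝔸} {s₀ a a₅ ρb Mv : ℝ}
  (I : SliceInputsLG 𝔇 χu χcu 𝒲 𝒪 c Sg Rz cs E₀ κE Z t φ s₀ a a₅ ρb Mv)

/-- **The box-support law AT A REAL BASE POINT** (dag-n10-c 46∕47's `hbox` binder for the law's box `χᵘ(s₀·)`): the s-free law read at `A := s₀·B`.
[cite: Balaban1987RG1, (2.9) p.266 and p.267; Balaban1988RG2Cluster, (2.3) p.12] -/
theorem hbox_smul (s : ℝ) : ∀ B : (𝔇.𝒦 Z t).Λ → ℝ, χu Z t (s • B) ≠ 0 → ∀ b ∈ I.S₀, |(s • B) b| ≤ I.ρ :=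
  fun B hB => I.hbox (s • B) hB

/-- `0 ≤ m₃ = C_p·K₀(4·2^d, 2d)` (the `hm₃0` binder). [cite: Balaban1988RG2Cluster, (2.20) p.16 (bookkeeping)] -/
theorem hm₃0 : 0 ≤ I.Cp * B12TreeDecay.K₀ (4 * 2 ^ P.d) (2 * P.d) :=
  mul_nonneg I.hCp (K₀_pos _ _).le

/-- **THE PER-BOND MULTIPLICITY OF THE RATE WEIGHT, DERIVED** (the `hm₃` binder; node00-def-W1 W1-12 `LocalGrowthInputs.hm₃`'s proof VERBATIM on this record: cube-location (G), the
(2.19) profile (P) and (1.26) ON THE TORUS `TreeLengthTorus.ineq126_torus`): `Σ_{Y ∈ 𝐃, b ∈ S Y} R(Y)c₃(Y) ≤ C_p·K₀(4·2^d, 2d)`. [cite: Balaban1988RG2Cluster, (2.19)-(2.20) p.16 and (1.26) p.8] -/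
theorem hm₃ : ∀ bd : (𝔇.𝒦 Z t).Λ, ∑ Y ∈ t.1 with bd ∈ I.S Y, I.R Y * I.c₃ Y ≤ I.Cp * B12TreeDecay.K₀ (4 * 2 ^ P.d) (2 * P.d) := by
  intro bd
  have h126 := ineq126_torus P.d (L * domCount P M (k + 1)) I.hκp (I.cubeOf bd)
  calc ∑ Y ∈ t.1 with bd ∈ I.S Y, I.R Y * I.c₃ Y
      ≤ ∑ Y ∈ t.1 with bd ∈ I.S Y, I.Cp * Real.exp (-I.κp * (tsys P.d (L * domCount P M (k + 1))).dj Y) :=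
        Finset.sum_le_sum fun Y hY => I.hdecay Y (Finset.mem_filter.1 hY).1
    _ ≤ ∑ Y ∈ (tcubeSys P.d (L * domCount P M (k + 1))).above (I.cubeOf bd),
          I.Cp * Real.exp (-I.κp * (tsys P.d (L * domCount P M (k + 1))).dj Y) := by
        refine Finset.sum_le_sum_of_subset_of_nonneg (fun Y hY => ?_) fun Y _ _ => mul_nonneg I.hCp (Real.exp_nonneg _)
        have hY' := Finset.mem_filter.1 hY
        exact (B12TreeDecay.CubeSystem.mem_above (G := tcubeSys P.d (L * domCount P M (k + 1))) (c := I.cubeOf bd)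
          (X := Y)).2 (I.hS Y hY'.1 bd hY'.2)
    _ = I.Cp * ∑ Y ∈ (tcubeSys P.d (L * domCount P M (k + 1))).above (I.cubeOf bd),
          Real.exp (-I.κp * (tsys P.d (L * domCount P M (k + 1))).dj Y) := by rw [Finset.mul_sum]
    _ ≤ I.Cp * B12TreeDecay.K₀ (4 * 2 ^ P.d) (2 * P.d) := mul_le_mul_of_nonneg_left h126 I.hCp

/-- **THE CENTRE's `Σ|τ||𝒪(old, φ; Y, 0)| ≤ w₀` ON THE τ-REGION, DERIVED** (J7a §2's `hw₀U` ∕ J9-D's `hw₀U_all`, now a consequence of (L0), the τ-radii and the closure `hw₀`), every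
admissible history. [cite: Balaban1988RG2Cluster, (2.18)-(2.20) p.16 and Lemma 2 p.11] -/
theorem hw₀U {old : OlderTerms P 𝔸 M k} (hA : old ∈ AdmHist (spaceOfRecord (M := M) Sg Rz (fun _ => cs.α₀) (fun _ => cs.α₁)) E₀ κE k) :
    ∀ τ : TDom P.d (L * domCount P M (k + 1)) → ℂ, (∀ Y, τ Y ∈ I.Uτ Y) → ∑ Y ∈ t.1, ‖τ Y‖ * ‖𝒪 Z t old φ Y 0‖ ≤ I.w₀ := fun τ hτ =>
  (Finset.sum_le_sum fun Y hY => mul_le_mul (I.hUτR Y hY (τ Y) (hτ Y)) (I.h0 old hA Y hY) (norm_nonneg _) (I.hR Y hY)).trans I.hw₀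

/-- **THE CENTRE's QUADRATIC-FORM LETTER `Σ|τ||𝒪(old, φ; Y, 0)| ≤ ½a₀⟨B,B⟩ + w₀`, DERIVED** (J7a §1's ∕ J8's `h220V0`, J9-D's `h220V0_all`; `a₀ ≥ 0`), every admissible history.
[cite: Balaban1988RG2Cluster, (2.18)-(2.20) p.16 and Lemma 2 p.11] -/
theorem h220V0 {old : OlderTerms P 𝔸 M k} (hA : old ∈ AdmHist (spaceOfRecord (M := M) Sg Rz (fun _ => cs.α₀) (fun _ => cs.α₁)) E₀ κE k) :
    ∀ τ : TDom P.d (L * domCount P M (k + 1)) → ℂ, (∀ Y, τ Y ∈ I.Uτ Y) → ∀ B : (𝔇.𝒦 Z t).Λ → ℝ,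
      ∑ Y ∈ t.1, ‖τ Y‖ * ‖𝒪 Z t old φ Y 0‖ ≤ I.a₀ / 2 * (B ⬝ᵥ B) + I.w₀ := fun τ hτ B =>
  (I.hw₀U hA τ hτ).trans (le_add_of_nonneg_left (mul_nonneg (div_nonneg I.ha₀ two_pos.le) (Finset.sum_nonneg fun i _ => mul_self_nonneg (B i))))

end Faces

end SliceInputsLG

/-- **THE CASE SPLIT ON THE LARGE-FIELD SET, WITH THE TWO RATES ASKED IN THEIR OWN REGIMES** (J7a §4 `vertexLetter_byCases` with `1 + T ≤ Mv` asked only on `P(t) = ∅` and `T_P ≤ Mv`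
only on `P(t) ≠ ∅` — the record's small-field ∕ large-field blocks after director-ym №193). [cite: Balaban1987RG1, (2.13) p.268] (elementary) -/
theorem vertexLetter_byCases' {P0 : Prop} [Decidable P0] {m cV : ℂ} {s₀ W T T' Mv : ℝ} (hW : 0 ≤ W)
    (h0 : P0 → ‖m - cV‖ ≤ (1 + T) * s₀ ^ 2 * W) (h1 : ¬P0 → ‖m - 0‖ ≤ T' * s₀ ^ 2 * W) (hMv : P0 → 1 + T ≤ Mv) (hMv' : ¬P0 → T' ≤ Mv) :
    ‖m - (if P0 then cV else 0)‖ ≤ Mv * s₀ ^ 2 * W := by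
  have hsW : 0 ≤ s₀ ^ 2 * W := mul_nonneg (sq_nonneg _) hW
  split_ifs with h
  · exact (h0 h).trans (by nlinarith [mul_le_mul_of_nonneg_right (hMv h) hsW])
  · exact (h1 h).trans (by nlinarith [mul_le_mul_of_nonneg_right (hMv' h) hsW])

/-! ## §1 The knit at the θ-free engine -/

section Engine


variable {F : T4Family} {M : ℕ} [NeZero M] {L : ℕ} [NeZero L] (Gn : (k₁ : ℕ) → GenTower (F.P k₁) (MatA N) M)
  (sp : (k j : ℕ) → (domSys (F.P k) M j).Dom → Set (CPair (F.P k) (MatA N)))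
  (gauge : (k : ℕ) → GaugeField (F.P k) 0 (Node00.SU N) → GaugeField (F.P k) 0 (Node00.SU N) → ℝ) (hg : ∀ k U U', 0 ≤ gauge k U U')
  (T₀ : (k : ℕ) → GaugeField (F.P (k + 1)) 0 (Node00.SU N) → GaugeField (F.P k) 0 (Node00.SU N))
  (hT₀ : ∀ (k : ℕ) (U : GaugeField (F.P (k + 1)) 0 (Node00.SU N)),
    (∀ (j : ℕ) (Y : (domSys (F.P (k + 1)) M j).Dom), ofBackgroundC (ιSU N) U ∈ sp (k + 1) j Y) →
    ∀ (j : ℕ) (Y : (domSys (F.P k) M j).Dom), ofBackgroundC (ιSU N) (T₀ k U) ∈ sp k j Y)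
  (li : LetterInputs) (θ : Stage12Params F N) (k : ℕ) (c : B13.Consts) (𝔇 : TermData214 c (F.P k) (MatA N) M L)
  (χu χcu : (k' : ℕ) → (Z : (domSys (F.P k) M (k' + 1)).Dom) → (t : TermLabel (F.P k) M k' L) → (((𝔇 k').𝒦 Z t).Λ → ℝ) → ℝ)
  (𝒲 : (k' : ℕ) → (Z : (domSys (F.P k) M (k' + 1)).Dom) → (t : TermLabel (F.P k) M k' L) → CPair (F.P k) (MatA N) →
    TDom (F.P k).d (L * domCount (F.P k) M (k' + 1)) → (((𝔇 k').𝒦 Z t).Λ → ℝ) → ℂ)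
  (𝒪 : (k' : ℕ) → (Z : (domSys (F.P k) M (k' + 1)).Dom) → (t : TermLabel (F.P k) M k' L) → OlderTerms (F.P k) (MatA N) M k' → CPair (F.P k) (MatA N) →
    TDom (F.P k).d (L * domCount (F.P k) M (k' + 1)) → (((𝔇 k').𝒦 Z t).Λ → ℝ) → ℂ)
  {G : Type*} [GaugeGroup G] (Sg : Setting (MatA N) G) (Rz : Residual (F.P k) (MatA N))


open Classical in
/-- **`N22At` AT THE ADMISSIBLE READING OF RECORD ON THE RUN TOWERS GENERATED BY THE (2.14) DATUM, FROM THE LOCATED INPUTS `SliceInputsLG` UNDER THE UNSCALED-FIELD LAW** — module J9's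
knit in the LOCAL-GROWTH ∕ ADMISSIBLE-HISTORY edition: J2ᴬ's engine with its eight member hypotheses DISCHARGED — hMbase (J5, law-free), hMagree (J5 under the law), hMan ∕ hVanD (the
record's φ-analyticity inputs at the slice `X := Z`), hMlast (J10a §1), hMprop (J10a §2), (P) (J8) and hMcen (J10b §3 + J7a §1 + J7a §2 through J7a §4 for `P(t) = ∅`; J10b §4
otherwise) at the member family of the datum and the centre `V := if P(t) = ∅ then term(A,Γ,F214 |P| 1 1 𝐃 (Y ↦ 𝒪(old,φ,Y,0))) else 0`.  Displayed: J2ᴬ's socket data (tables + their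
restriction property, numerals at `a₅′` with STRICT [KP86] clause, slack, S25, renewal, apertures `0 < cA < cP < 1`, `cP∕(1−cP) < ρb < 1`, `Mv`, the smallness and the letter relation);
the UNSCALED-FIELD LAW of the datum on the window (W1-11 BY NAME); and, PER SLICE, ONE record `SliceInputsLG` (J10-D) of located inputs — every older-term letter over W1-13's admissible
class, NO joint (2.20) letter of the unclipped pair; node N18 below `k`; the letter signs.  Conclusion: `N22At (u3OfRecord₁₂ θ (Dr.u3Objects θ.γ) k)`.
[cite: Balaban1988RG2Cluster, (1.34)-(1.36) p.9, (1.41) p.11, (2.9)-(2.15) pp.14-16, (2.16)-(2.26) pp.16-17, Lemma 3 p.20 and (2.39)-(2.41) p.21; Balaban1987RG1, §1 p.263, (2.9)-(2.13) pp.266-268] -/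
theorem n22At_u3OfRecord₁₂_ofRecordAdm_runTowers_toClusterTower_of_n18Below_unscaledLawDatumLG {cs : SFConsts} (hGn : Gn k = 𝔇.Gn)
    (hspk : ∀ (j : ℕ) (Y : (domSys (F.P k) M j).Dom), sp k j Y ⊆ spaceI Sg Rz M j (domSites (F.P k) M j Y) cs.α₀ cs.α₁)
    (hrestr : ∀ j : ℕ, SpRestr (M := M) (fun Y : (domSys (F.P k) M (j + 1)).Dom => spaceI Sg Rz M (j + 1) (domSites (F.P k) M (j + 1) Y) cs.α₀ cs.α₁))
    (hL : 8 ≤ c.L) (hLc : c.L = L) {a a₂ a₂' a₅ a₅' Aabs : ℝ} (hN : Lemma3Numerics c M ((c.L : ℝ) / 2) a a₂ a₂' a₅' Aabs)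
    {E₀ r₁ Mv cA cP ρb : ℝ} (hA0 : 0 ≤ c.C3act * c.ε₁) (hr₁ : 0 ≤ r₁) (hκ : li.κ ≤ r₁)
    (hrate : r₁ + 2 * (64 * Real.log 162) + 2 ≤ (1 - 8 * c.δ) * ((c.L : ℝ) / 2) * c.κ)
    (hsmall : c.C3act * c.ε₁ * Real.exp (5 * r₁ + 1) * K₀ 64 8 * 9 * 64 < 1)
    (hrenew : Real.exp 1 * 9 * 64 * K₀ 64 8 ^ 2 * (c.C3act * c.ε₁) ≤ E₀)
    (h2w : ∀ (k' : ℕ) (Z : (domSys (F.P k) M (k' + 1)).Dom), 2 * Real.exp (a₅ * ((Z.1).card : ℝ)) ≤ Real.exp (a₅' * ((Z.1).card : ℝ)))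
    -- apertures: displayed discs `cA` < producer's sector `cP` < 1, producer's ball radius `ρb`
    (hc0 : 0 < cA) (hcAP : cA < cP) (hcP1 : cP < 1) (hρb : cP / (1 - cP) < ρb)
    (hMv : 0 < Mv) (hMvγ : (1 - cP)⁻¹ ^ 2 * Mv * ((1 + cA) * θ.γ) ^ 2 ≤ 1 / 2) (hAM : 2 * ((1 - cP)⁻¹ ^ 2 * Mv) * E₀ * (1 + cA) ^ 2 ≤ li.A)
    -- THE UNSCALED-FIELD LAW of the datum's last-line data on the real window ([I] (2.9)–(2.12)) — node00-def-W1's W1-11 `TermData214.UnscaledFieldLawOn` BY NAME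
    (hlaw : 𝔇.UnscaledFieldLawOn χu χcu 𝒲 𝒪 θ.γ)
    (hκ₁ : 1 ≤ c.κ₁) (hα₆ : c.α₆ ≠ 0) (hρb1 : ρb < 1)
    -- THE LOCATED INPUTS, one record per slice (k′ < k, φ in the table, Z ⊆ X, t ∈ terms, s₀ ∈ window)
    (ι : ∀ k' : ℕ, k' < k → ∀ (X : (domSys (F.P k) M (k' + 1)).Dom) (φ : CPair (F.P k) (MatA N)),
      φ ∈ spaceI Sg Rz M (k' + 1) (domSites (F.P k) M (k' + 1) X) cs.α₀ cs.α₁ → ∀ (Z : (domSys (F.P k) M (k' + 1)).Dom), Z.1 ⊆ X.1 → ∀ t ∈ terms L M Z, ∀ s₀ ∈ Ioc (0 : ℝ) θ.γ,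
      SliceInputsLG (𝔇 k') (χu k') (χcu k') (𝒲 k') (𝒪 k') c Sg Rz cs E₀ li.κ Z t φ s₀ a a₅ ρb Mv)
    (h18 : ∀ k' : ℕ, k' < k →
      N18At (u3OfRecord₁₂ θ ((ReadingData.ofRecordAdm F M N (runTowers fun k₁ => toClusterTower (Gn k₁)) sp gauge hg T₀ hT₀ li).u3Objects θ.γ) k'))
    (hC5 : 0 ≤ li.C₅) (hθ1 : li.θ₅ < 1) (hC₀' : 2 * li.C₅ / (1 - li.θ₅) ≤ li.C₀)
    (hC₀ : 0 < li.C₀) (hθ5 : 0 < li.θ₅) (hA : 0 < li.A) (hμ : li.μ = 1) (hr : 0 < li.r) (hrc : li.r ≤ min cA 1) (hγ : 0 < θ.γ) (hs : li.s = (2 : ℝ)⁻¹) :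
    N22At (u3OfRecord₁₂ θ ((ReadingData.ofRecordAdm F M N (runTowers fun k₁ => toClusterTower (Gn k₁)) sp gauge hg T₀ hT₀ li).u3Objects θ.γ) k) := by
  -- positivity of the (2.26) weight (for the `else 0` branches)
  have hA6 : 0 ≤ c.α₆ * c.eps2 := mul_nonneg hN.hα₆.le hN.hε₀
  have hE₀ : 0 ≤ E₀ := le_trans (by positivity) hrenew
  have hWnn : ∀ (k' : ℕ) (Z : (domSys (F.P k) M (k' + 1)).Dom) (t : TermLabel (F.P k) M k' L),
      0 ≤ weight L M c Z a t * Real.exp (a₅ * ((Z.1).card : ℝ)) := fun k' Z t => mul_nonneg (weight_nonneg c Z a hA6 t) (Real.exp_pos _).le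
  have hγw : θ.γ ∈ Ioc (0 : ℝ) θ.γ := ⟨hγ, le_rfl⟩
  -- the guard of the record: (1.18)`(E₀, li.κ)` on the tables of record ∧ analytic there ⟺ `old ∈ W1.AdmHist (W1.spaceOfRecord …) E₀ li.κ k′` (W1-13, `Iff.rfl`)
  have hadm : ∀ (k' : ℕ) (old : OlderTerms (F.P k) (MatA N) M k'),
      (∀ (j : Fin (k' + 1)) (Y : (domSys (F.P k) M j).Dom) (ψ : CPair (F.P k) (MatA N)), ψ ∈ spaceI Sg Rz M j (domSites (F.P k) M j Y) cs.α₀ cs.α₁ →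
        ‖old j Y ψ‖ ≤ E₀ * Real.exp (-(li.κ * torusTreeLen Y.1))) →
      (∀ (j : Fin (k' + 1)) (Y : (domSys (F.P k) M j).Dom), AnalyticOnNhd ℂ (old j Y) (spaceI Sg Rz M j (domSites (F.P k) M j Y) cs.α₀ cs.α₁)) →
      old ∈ AdmHist (spaceOfRecord (M := M) Sg Rz (fun _ => cs.α₀) (fun _ => cs.α₁)) E₀ li.κ k' :=
    fun k' old hold han => (mem_AdmHist_spaceOfRecord_const_iff Sg Rz cs.α₀ cs.α₁ E₀ li.κ old).2 ⟨hold, han⟩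
  -- the (T-an) guard (class rate `r₁`, `d_j`) implies the record's guard (`li.κ ≤ r₁`, `d_j = torusTreeLen` by `rfl`)
  have hadm' : ∀ (k' : ℕ) (old : OlderTerms (F.P k) (MatA N) M k'),
      (∀ (j : Fin (k' + 1)) (Y : (domSys (F.P k) M j).Dom), ∀ ψ ∈ spaceI Sg Rz M j (domSites (F.P k) M j Y) cs.α₀ cs.α₁,
          ‖old j Y ψ‖ ≤ E₀ * Real.exp (-(r₁ * (domSys (F.P k) M j).dj Y))) →
      (∀ (j : Fin (k' + 1)) (Y : (domSys (F.P k) M j).Dom), AnalyticOnNhd ℂ (old j Y) (spaceI Sg Rz M j (domSites (F.P k) M j Y) cs.α₀ cs.α₁)) →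
      old ∈ AdmHist (spaceOfRecord (M := M) Sg Rz (fun _ => cs.α₀) (fun _ => cs.α₁)) E₀ li.κ k' := by
    intro k' old hB han
    refine hadm k' old (fun j Y ψ hψ => (hB j Y ψ hψ).trans (mul_le_mul_of_nonneg_left (Real.exp_le_exp.mpr ?_) hE₀)) han
    show -(r₁ * torusTreeLen Y.1) ≤ -(li.κ * torusTreeLen Y.1)
    exact neg_le_neg (mul_le_mul_of_nonneg_right hκ (torusTreeLen_nonneg Y.1))
  refine n22At_u3OfRecord₁₂_ofRecordAdm_runTowers_toClusterTower_of_n18Below_windowDilatedTermDatumAdm Gn sp gauge hg T₀ hT₀ li θ k c 𝔇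
    (fun s₀ k' Z t b old φ => term214 (𝔇 k').r (sigmaList L Z t) (tauList (F.P k) M k' L t)
          (core214 (fun σ => b ^ 2 • (𝔇 k').A Z t φ σ) (fun σ X => b • (𝔇 k').Gam Z t φ σ X)
            (F214 t.2.card (fun B => χu k' Z t (s₀ • B)) (fun B => χcu k' Z t (s₀ • B)) t.1
              (fun Y B => b ^ 2 * ((((s₀ : ℝ) : ℂ) ^ 2)⁻¹ * 𝒲 k' Z t φ Y (s₀ • B)) + 𝒪 k' Z t old φ Y (s₀ • B)))) 0 0)
    (fun k' Z t old φ => if t.2 = ∅ then term214 (𝔇 k').r (sigmaList L Z t) (tauList (F.P k) M k' L t)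
            (core214 ((𝔇 k').A Z t φ) ((𝔇 k').Gam Z t φ) (F214 t.2.card (fun _ => (1 : ℝ)) (fun _ => (1 : ℝ)) t.1 (fun Y _ => 𝒪 k' Z t old φ Y 0))) 0 0 else 0)
    Sg Rz hGn hspk hrestr hL hLc hN hA0 hr₁ hκ hrate hsmall hrenew h2w hc0 hcAP hcP1 hρb hMv hMvγ hAM ?_ ?_ ?_ ?_ ?_ ?_ ?_ ?_ h18 hC5 hθ1 hC₀' hC₀ hθ5 hA hμ hr hrc hγ hs
  · -- hMbase: J5, law-free
    intro k' Z t old φ s₀ hs₀ s₁ hs₁ b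
    exact memberOfDatum_basePoint 𝔇 χu χcu 𝒲 𝒪 k' Z t old φ s₀ hs₀ s₁ hs₁ b
  · -- hMagree: J5 under the unscaled-field law
    intro k' Z t s hs' old φ
    exact memberOfDatum_one_eq_TF 𝔇 χu χcu 𝒲 𝒪 ((TermData214.unscaledFieldLawOn_iff 𝔇 χu χcu 𝒲 𝒪 θ.γ).1 hlaw) k' Z t s hs' old φ
  · -- (T-an)ʷ hMan: the record's φ-analyticity input at the slice `(X := Z)` through every point of the table
    intro k' hk s₀ hs₀ b hb old hB han Z t ht φ hφ
    have hA := hadm' k' old hB han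
    have I := ι k' hk Z φ hφ Z (Finset.Subset.refl _) t ht s₀ hs₀
    exact I.hMan old hA b hb
  · -- (T-an)[V] hVanD: the centre is the record's `hVan` on `P(t) = ∅`, the constant `0` otherwise
    intro k' hk old hB han Z t ht φ hφ
    have hA := hadm' k' old hB han
    have I := ι k' hk Z φ hφ Z (Finset.Subset.refl _) t ht θ.γ hγw
    by_cases hP : t.2 = ∅
    · have hfun : (fun ψ : CPair (F.P k) (MatA N) => if t.2 = ∅ then term214 (𝔇 k').r (sigmaList L Z t) (tauList (F.P k) M k' L t)
            (core214 ((𝔇 k').A Z t ψ) ((𝔇 k').Gam Z t ψ) (F214 t.2.card (fun _ => (1 : ℝ)) (fun _ => (1 : ℝ)) t.1 (fun Y _ => 𝒪 k' Z t old ψ Y 0))) 0 0 else 0) =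
          fun ψ => term214 (𝔇 k').r (sigmaList L Z t) (tauList (F.P k) M k' L t)
            (core214 ((𝔇 k').A Z t ψ) ((𝔇 k').Gam Z t ψ) (F214 t.2.card (fun _ => (1 : ℝ)) (fun _ => (1 : ℝ)) t.1 (fun Y _ => 𝒪 k' Z t old ψ Y 0))) 0 0 :=
        funext fun ψ => if_pos hP
      rw [hfun]
      exact I.hVan old hA hP
    · have hfun : (fun ψ : CPair (F.P k) (MatA N) => if t.2 = ∅ then term214 (𝔇 k').r (sigmaList L Z t) (tauList (F.P k) M k' L t)
            (core214 ((𝔇 k').A Z t ψ) ((𝔇 k').Gam Z t ψ) (F214 t.2.card (fun _ => (1 : ℝ)) (fun _ => (1 : ℝ)) t.1 (fun Y _ => 𝒪 k' Z t old ψ Y 0))) 0 0 else 0) =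
          fun _ => 0 := funext fun ψ => if_neg hP
      rw [hfun]
      exact analyticAt_const
  · -- hMlast: J10a §1 at the slice (local growth letters; the older-term letters at the admissible `old`)
    intro k' hk old hold han X φ hφ Z hZ t ht s₀ hs₀
    have hA := hadm k' old hold han
    have I := ι k' hk X φ hφ Z hZ t ht s₀ hs₀
    exact differentiableOn_and_norm_memberOfDatum_le_weight_of_localGrowth (𝔇 k') (χu k') (χcu k') (𝒲 k') (𝒪 k') Z t old φ s₀ c hκ₁ hα₆ I.hpos I.hhalf I.hUσ I.hUτ I.hUexp I.hUtau I.hr I.hr' I.hsubτ I.hχ0 I.hχc0 hs₀.1 I.hρ.le I.hAhol I.hχm I.hχcm I.h𝒲m (I.h𝒪m old hA) I.hAs I.hGhol I.qP I.h222 I.hγ₂ I.hqP I.hR I.hc₃ I.hc₁ I.hUτR (I.h0 old hA) I.S I.h1loc (I.h4 old hA) I.hm₃0 I.hm₃ I.S₀ (I.hbox_smul s₀) I.hloc𝒲 (I.hloc𝒪 old hA) I.hfibN I.hkap'' I.hk1 I.hk2 I.hθE I.hθΓ I.hθC I.hKG I.hKΓ I.hKCs I.hK₀ I.hKE I.hG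 I.hΓ₀ I.hCs I.hC216 I.hCE I.hdΓ I.hdC I.hdE hρb1 I.hKG' I.hKCs' I.hθΓ' I.hθC' I.hθE' I.ha' I.hw' I.hθEle I.hθΓle I.hθR1le I.hsmallKθ I.hc0 I.hc I.hαc I.hg I.hΓq I.hsmall (a := a) (a₅ := a₅) I.hPa I.hvol
  · -- hMprop: J10a §2 at the slice, along the curve (its values admissible pointwise)
    intro k' hk i hi O hO s₀ hs₀ b hb cv hcv hcvA X φ hφ Z hZ t ht
    have hAcv : ∀ z ∈ O, cv z ∈ AdmHist (spaceOfRecord (M := M) Sg Rz (fun _ => cs.α₀) (fun _ => cs.α₁)) E₀ li.κ k' := fun z hz => hadm k' (cv z) (fun j Y ψ hψ => (hcv j Y ψ hψ).2 z hz) (hcvA z hz)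
    have I := ι k' hk X φ hφ Z hZ t ht s₀ hs₀
    exact differentiableOn_and_norm_memberOfDatum_history_of_localGrowth (𝔇 k') (χu k') (χcu k') (𝒲 k') (𝒪 k') Z t φ s₀ hO cv c hκ₁ hα₆ I.hUσ I.hUτ I.hUexp I.hr I.hr' I.hsubτ I.hpos I.hhalf I.hUtau I.hχ0 I.hχc0 hs₀.1 I.hρ.le I.hAhol I.hχm I.hχcm I.h𝒲m (fun z hz => I.h𝒪m (cv z) (hAcv z hz)) (fun Y A => I.hOhol O hO cv hcv hcvA Y A) I.hAs I.hGhol I.qP I.h222 I.hγ₂ I.hqP I.hR I.hc₃ I.hc₁ I.hUτR (fun z hz => I.h0 (cv z) (hAcv z hz)) I.S I.h1loc (fun z hz => I.h4 (cv z) (hAcv z hz)) I.hm₃0 I.hm₃ I.S₀ (I.hbox_smul s₀) I.hloc𝒲 (fun z hz => I.hloc𝒪 (cv z) (hAcv z hz)) I.hfibN I.hkap'' I.hk1 I.hk2 I.hθE I.hθΓ I.hθC I.hKG I.hKΓ I.hKCs I.hK₀ I.hKE I.hG I.hΓ₀ I.hCs I.hC216 I.hCE I.hdΓ I.hdC I.hdE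 hρb1 I.hKG' I.hKCs' I.hθΓ' I.hθC' I.hθE' I.ha' I.hw' I.hθEle I.hθΓle I.hθR1le I.hsmallKθ I.hc0 I.hg I.hc I.hαc I.hΓq I.hsmall (a := a) (a₅ := a₅) I.hPa I.hvol hb
  · -- (P) for the centre: J8 at the slice of base point γ, by cases on the large-field set; its `Σ|τ||𝒪(·,0)|` letter DERIVED from (L0) + the τ-radii + `hw₀`
    intro k' hk O hO cv hcv hcvA X φ hφ Z hZ t ht
    have hAcv : ∀ z ∈ O, cv z ∈ AdmHist (spaceOfRecord (M := M) Sg Rz (fun _ => cs.α₀) (fun _ => cs.α₁)) E₀ li.κ k' := fun z hz => hadm k' (cv z) (fun j Y ψ hψ => (hcv j Y ψ hψ).2 z hz) (hcvA z hz)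
    have I := ι k' hk X φ hφ Z hZ t ht θ.γ hγw
    refine propV_byCases (hWnn k' Z t) fun hP => ?_
    have hP0 : t.2.card = 0 := by rw [hP, Finset.card_empty]
    exact differentiableOn_and_norm_centreOfDatum_of_primitives (𝔇 k') (𝒪 k') Z t φ hP0 hO cv (fun Y => I.hOhol O hO cv hcv hcvA Y 0) c hκ₁ hα₆ I.hpos I.hhalf I.hUσ I.hUτ I.hUexp I.hUtau I.hr I.hr' I.hsubτ I.hAhol I.hAs I.hA I.hGhol (a₂₀ := I.a₀) (w := I.w₀) I.hγ₂ I.ha₀ I.hfibN I.hkap'' I.hk1 I.hk2 I.hθE I.hθΓ I.hθC I.hKG I.hKΓ I.hKCs I.hK₀ I.hθEle0 I.hθΓle0 I.hθR1le0 I.hG I.hΓ₀ I.hCs I.hC216 I.hdΓ I.hdC I.hdE I.hsmallKθ I.hc0 I.hc I.hαc_0 I.hg I.hΓq I.hsmall_0 (a := a) (a₅ := a₅) I.hPa I.hvol_0 (fun z hz => I.h220V0 (hAcv z hz))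
  · -- hMcen: the three pieces (J10b §3, J7a §1, J7a §2) for P(t) = ∅, the large-field surplus (J10b §4) otherwise
    intro k' hk old hold han X φ hφ Z hZ t ht s₀ hs₀ b hb
    have hA := hadm k' old hold han
    have I := ι k' hk X φ hφ Z hZ t ht s₀ hs₀
    refine vertexLetter_byCases' (hWnn k' Z t) (fun hP => ?_) (fun hP => ?_) I.hMvT I.hMvP
    · have hP0 : t.2.card = 0 := by rw [hP, Finset.card_empty]
      exact vertexLetter_of_threePieces (hWnn k' Z t)
        (norm_memberOfDatum_sub_boxedCentre_le_of_localGrowth (𝔇 k') (χu k') (χcu k') (𝒲 k') (𝒪 k') Z t old φ s₀ c hκ₁ hα₆ I.hpos I.hhalf I.hUσ I.hUτ I.hUexp I.hUtau I.hr I.hr' I.hsubτ I.hχ0 I.hχc0 I.hχe I.hχce I.𝒲₃ (I.D𝒪 old) hs₀.1 I.hρ I.h𝒲m (I.h𝒪m old hA) I.h𝒲₃m (I.hD𝒪m old hA) I.h𝒲₃ (I.hD𝒪 old hA) I.hAhol I.hχm I.hχcm I.hAs I.hGhol I.qP I.h222 I.hγ₂ I.hqP I.hδ I.hR I.hc₃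 I.hc₃' I.hc₄ I.hc₁ I.hc₁' I.hc₂ I.hUτR (I.h0 old hA) I.h1 I.S I.h1loc I.hm₃0 I.hm₃ I.h2 I.h3 (I.h4 old hA) (I.h5 old hA) (I.h6 old hA) I.S₀ (I.hbox_smul s₀) I.hloc𝒲 (I.hloc𝒪 old hA) I.hac I.hwc I.hfibN I.hkap'' I.hk1 I.hk2 I.hθE I.hθΓ I.hθC I.hKG I.hKΓ I.hKCs I.hK₀ I.hKE I.hG I.hΓ₀ I.hCs I.hC216 I.hCE I.hdΓ I.hdC I.hdE hρb1 I.hKG' I.hKCs' I.hθΓ' I.hθC' I.hθE' I.hθEle I.hθΓle I.hθR1le I.hsmallKθ I.hc0 I.hc I.hαc_c I.hg I.hΓq I.hsmall_c (a := a) (a₅ := a₅) I.hPa I.hvol_c hb)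
        (norm_boxTail_memberOfDatum_le_of_primitives (𝔇 k') (χu k') (χcu k') (𝒪 k') Z t old φ s₀ c hκ₁ hα₆ I.hpos I.hhalf I.hUσ I.hUτ I.hUexp I.hUtau I.hr I.hr' I.hsubτ I.hχ0 I.hχc0 (I.hχ1 hP) I.hκ (I.hboxR hP) I.hAhol I.hχm I.hχcm (fun Y => measurable_const) I.hAs I.hGhol hP0 I.ha₀ (I.h220V0 hA) I.hfibN I.hkap'' I.hk1 I.hk2 I.hθE I.hθΓ I.hθC I.hKG I.hKΓ I.hKCs I.hK₀ I.hKE I.hG I.hΓ₀ I.hCs I.hC216 I.hCE I.hdΓ I.hdC I.hdE hρb1 I.hKG' I.hKCs' I.hθΓ' I.hθC' I.hθE' I.hθEle I.hθΓle I.hθR1le I.hsmallKθ I.hc0 I.hc I.hαc_b I.hg I.hΓq I.hsmall_b (a := a) (a₅ := a₅) I.hvol_b hb)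
        (boxFreeCentre_memberOfDatum_eq_of_primitives (𝔇 k') (𝒪 k') Z t old φ c I.hUσ I.hUτ I.hUexp I.hr I.hr' I.hsubτ I.hAhol I.hAs I.hGhol (I.hw₀U hA) I.hfibN I.hkap'' I.hk1 I.hk2 I.hθE I.hθΓ I.hθC I.hKG I.hKΓ I.hKCs I.hK₀ I.hKE I.hG I.hΓ₀ I.hCs I.hC216 I.hCE I.hdΓ I.hdC I.hdE hρb1 I.hKG' I.hKCs' I.hθΓ' I.hθC' I.hθE' I.hθEle I.hθΓle I.hθR1le I.hsmallKθ I.hc0 I.hc I.hα₀ I.hαc_f I.hΓq I.hsmall_f b hb) (I.hRb hP)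
    · have hP1 : 1 ≤ t.2.card := Finset.card_pos.2 (Finset.nonempty_iff_ne_empty.2 hP)
      exact vertexLetter_of_largeField (hWnn k' Z t)
        (norm_memberOfDatum_le_largeField_of_localGrowth (𝔇 k') (χu k') (χcu k') (𝒲 k') (𝒪 k') Z t old φ s₀ c hκ₁ hα₆ I.hpos I.hhalf I.hUσ I.hUτ I.hUexp I.hUtau I.hr I.hr' I.hsubτ I.hχ0 I.hχc0 hs₀.1 I.hρ.le I.hAhol I.hχm I.hχcm I.h𝒲m (I.h𝒪m old hA) I.hAs I.hGhol I.qP I.h222 I.hγ₂ I.hqP (I.hr₁ hP) hP1 I.hR I.hc₃ I.hc₁ I.hUτR (I.h0 old hA) I.S I.h1loc (I.h4 old hA) I.hm₃0 I.hm₃ I.S₀ (I.hbox_smul s₀) I.hloc𝒲 (I.hloc𝒪 old hA) I.hfibN I.hkap'' I.hk1 I.hk2 I.hθE I.hθΓ I.hθC I.hKG I.hKΓ I.hKCs I.hK₀ I.hKE I.hG I.hΓ₀ I.hCs I.hC216 I.hCE I.hdΓ I.hdC I.hdE hρb1 I.hKG' I.hKCs' I.hθΓ' I.hθC' I.hθE'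 I.ha' I.hw' I.hθEle I.hθΓle I.hθR1le I.hsmallKθ I.hc0 I.hc I.hαc I.hg I.hΓq I.hsmall (a := a) (a₅ := a₅) (I.hPa1 hP) I.hvol b hb) (I.hTP hP)

end Engine

/-! ## §2 The engine at one Stage-13 tuple -/

section Engine13


variable {F : T4Family} (θ : Stage13Params F N) {L : ℕ} [NeZero L] (Gn : (k₁ : ℕ) → GenTower (F.P k₁) (MatA N) θ.τ9.M)
  (sp : (k j : ℕ) → (domSys (F.P k) θ.τ9.M j).Dom → Set (CPair (F.P k) (MatA N)))
  (gauge : (k : ℕ) → GaugeField (F.P k) 0 (Node00.SU N) → GaugeField (F.P k) 0 (Node00.SU N) → ℝ) (hg : ∀ k U U', 0 ≤ gauge k U U')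
  (T₀ : (k : ℕ) → GaugeField (F.P (k + 1)) 0 (Node00.SU N) → GaugeField (F.P k) 0 (Node00.SU N))
  (hT₀ : ∀ (k : ℕ) (U : GaugeField (F.P (k + 1)) 0 (Node00.SU N)),
    (∀ (j : ℕ) (Y : (domSys (F.P (k + 1)) θ.τ9.M j).Dom), ofBackgroundC (ιSU N) U ∈ sp (k + 1) j Y) →
    ∀ (j : ℕ) (Y : (domSys (F.P k) θ.τ9.M j).Dom), ofBackgroundC (ιSU N) (T₀ k U) ∈ sp k j Y)
  (li : LetterInputs) (k : ℕ) (c : B13.Consts) (𝔇 : TermData214 c (F.P k) (MatA N) θ.τ9.M L)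
  (χu χcu : (k' : ℕ) → (Z : (domSys (F.P k) θ.τ9.M (k' + 1)).Dom) → (t : TermLabel (F.P k) θ.τ9.M k' L) → (((𝔇 k').𝒦 Z t).Λ → ℝ) → ℝ)
  (𝒲 : (k' : ℕ) → (Z : (domSys (F.P k) θ.τ9.M (k' + 1)).Dom) → (t : TermLabel (F.P k) θ.τ9.M k' L) → CPair (F.P k) (MatA N) →
    TDom (F.P k).d (L * domCount (F.P k) θ.τ9.M (k' + 1)) → (((𝔇 k').𝒦 Z t).Λ → ℝ) → ℂ)
  (𝒪 : (k' : ℕ) → (Z : (domSys (F.P k) θ.τ9.M (k' + 1)).Dom) → (t : TermLabel (F.P k) θ.τ9.M k' L) → OlderTerms (F.P k) (MatA N) θ.τ9.M k' → CPair (F.P k) (MatA N) →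
    TDom (F.P k).d (L * domCount (F.P k) θ.τ9.M (k' + 1)) → (((𝔇 k').𝒦 Z t).Λ → ℝ) → ℂ)
  {G : Type*} [GaugeGroup G] (Sg : Setting (MatA N) G) (Rz : Residual (F.P k) (MatA N))

open Classical in
/-- **§1 AT ONE STAGE-13 TUPLE** (`NeZero θ.τ9.M` from the context; the Stage-13 bundle IS the Stage-12 bundle of `θ.toStage12Params`, `u3OfRecord₁₃_eq_u3OfRecord₁₂`) — the face the
keyed binder storeys instantiate once per tuple. [cite: Balaban1988RG2Cluster, (2.9)-(2.15) pp.14-16, (2.26) p.17, Lemma 3 p.20 and (2.39)-(2.41) p.21; Balaban1987RG1, §1 p.263, (2.9)-(2.13) pp.266-268] -/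
theorem n22At_u3OfRecord₁₃_ofRecordAdm_runTowers_toClusterTower_of_n18Below_unscaledLawDatumLG [NeZero θ.τ9.M] {cs : SFConsts} (hGn : Gn k = 𝔇.Gn)
    (hspk : ∀ (j : ℕ) (Y : (domSys (F.P k) θ.τ9.M j).Dom), sp k j Y ⊆ spaceI Sg Rz θ.τ9.M j (domSites (F.P k) θ.τ9.M j Y) cs.α₀ cs.α₁)
    (hrestr : ∀ j : ℕ, SpRestr (M := θ.τ9.M) (fun Y : (domSys (F.P k) θ.τ9.M (j + 1)).Dom => spaceI Sg Rz θ.τ9.M (j + 1) (domSites (F.P k) θ.τ9.M (j + 1) Y) cs.α₀ cs.α₁))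
    (hL : 8 ≤ c.L) (hLc : c.L = L) {a a₂ a₂' a₅ a₅' Aabs : ℝ} (hN : Lemma3Numerics c θ.τ9.M ((c.L : ℝ) / 2) a a₂ a₂' a₅' Aabs)
    {E₀ r₁ Mv cA cP ρb : ℝ} (hA0 : 0 ≤ c.C3act * c.ε₁) (hr₁ : 0 ≤ r₁) (hκ : li.κ ≤ r₁)
    (hrate : r₁ + 2 * (64 * Real.log 162) + 2 ≤ (1 - 8 * c.δ) * ((c.L : ℝ) / 2) * c.κ)
    (hsmall : c.C3act * c.ε₁ * Real.exp (5 * r₁ + 1) * K₀ 64 8 * 9 * 64 < 1)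
    (hrenew : Real.exp 1 * 9 * 64 * K₀ 64 8 ^ 2 * (c.C3act * c.ε₁) ≤ E₀)
    (h2w : ∀ (k' : ℕ) (Z : (domSys (F.P k) θ.τ9.M (k' + 1)).Dom), 2 * Real.exp (a₅ * ((Z.1).card : ℝ)) ≤ Real.exp (a₅' * ((Z.1).card : ℝ)))
    -- apertures: displayed discs `cA` < producer's sector `cP` < 1, producer's ball radius `ρb`
    (hc0 : 0 < cA) (hcAP : cA < cP) (hcP1 : cP < 1) (hρb : cP / (1 - cP) < ρb)
    (hMv : 0 < Mv) (hMvγ : (1 - cP)⁻¹ ^ 2 * Mv * ((1 + cA) * θ.γ) ^ 2 ≤ 1 / 2) (hAM : 2 * ((1 - cP)⁻¹ ^ 2 * Mv) * E₀ * (1 + cA) ^ 2 ≤ li.A)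
    -- THE UNSCALED-FIELD LAW of the datum's last-line data on the real window ([I] (2.9)–(2.12)) — node00-def-W1's W1-11 `TermData214.UnscaledFieldLawOn` BY NAME
    (hlaw : 𝔇.UnscaledFieldLawOn χu χcu 𝒲 𝒪 θ.γ)
    (hκ₁ : 1 ≤ c.κ₁) (hα₆ : c.α₆ ≠ 0) (hρb1 : ρb < 1)
    -- THE LOCATED INPUTS, one record per slice (k′ < k, φ in the table, Z ⊆ X, t ∈ terms, s₀ ∈ window)
    (ι : ∀ k' : ℕ, k' < k → ∀ (X : (domSys (F.P k) θ.τ9.M (k' + 1)).Dom) (φ : CPair (F.P k) (MatA N)),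
      φ ∈ spaceI Sg Rz θ.τ9.M (k' + 1) (domSites (F.P k) θ.τ9.M (k' + 1) X) cs.α₀ cs.α₁ → ∀ (Z : (domSys (F.P k) θ.τ9.M (k' + 1)).Dom), Z.1 ⊆ X.1 → ∀ t ∈ terms L θ.τ9.M Z, ∀ s₀ ∈ Ioc (0 : ℝ) θ.γ,
      SliceInputsLG (𝔇 k') (χu k') (χcu k') (𝒲 k') (𝒪 k') c Sg Rz cs E₀ li.κ Z t φ s₀ a a₅ ρb Mv)
    (h18 : ∀ k' : ℕ, k' < k →
      N18At (u3OfRecord₁₃ θ ((ReadingData.ofRecordAdm F θ.τ9.M N (runTowers fun k₁ => toClusterTower (Gn k₁)) sp gauge hg T₀ hT₀ li).u3Objects θ.γ) k'))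
    (hC5 : 0 ≤ li.C₅) (hθ1 : li.θ₅ < 1) (hC₀' : 2 * li.C₅ / (1 - li.θ₅) ≤ li.C₀)
    (hC₀ : 0 < li.C₀) (hθ5 : 0 < li.θ₅) (hA : 0 < li.A) (hμ : li.μ = 1) (hr : 0 < li.r) (hrc : li.r ≤ min cA 1) (hγ : 0 < θ.γ) (hs : li.s = (2 : ℝ)⁻¹) :
    N22At (u3OfRecord₁₃ θ ((ReadingData.ofRecordAdm F θ.τ9.M N (runTowers fun k₁ => toClusterTower (Gn k₁)) sp gauge hg T₀ hT₀ li).u3Objects θ.γ) k) := by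
  rw [u3OfRecord₁₃_eq_u3OfRecord₁₂]
  exact n22At_u3OfRecord₁₂_ofRecordAdm_runTowers_toClusterTower_of_n18Below_unscaledLawDatumLG Gn sp gauge hg T₀ hT₀ li θ.toStage12Params k c 𝔇 χu χcu 𝒲 𝒪 Sg Rz hGn hspk
    hrestr hL hLc hN hA0 hr₁ hκ hrate hsmall hrenew h2w hc0 hcAP hcP1 hρb hMv hMvγ hAM hlaw hκ₁ hα₆ hρb1 ι
    (fun k' hk => by rw [← u3OfRecord₁₃_eq_u3OfRecord₁₂]; exact h18 k' hk) hC5 hθ1 hC₀' hC₀ hθ5 hA hμ hr hrc hγ hs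

end Engine13

end YMDAG.N22.W1

end
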